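import Summits.QuantumFields.YangMills.Theorems.BalabanUVNodesN11K1WitnessGaussPinHAtZ
import Literature.MathematicalPhysics.QuantumFieldTheory.Balaban1983to89.Node00.N24ItemsStage13AtThm1CCMWZBSepCoPH

/-!
# DAG node N11 — THE K1 DOOR AT THE CERTIFICATE OF THE εbg-LETTER z-WITNESS `θᴳᶻᴮ := gaussPinH (Stage13HParams.ofHistoryBlind F N ⟨θ₁₅ᶜᶜᴹᵂᶻᴮ(j; γ; εbg; Efl, logz), Zr⟩)`:
# the `rfl` faces, K⁰'s ANTECEDENT from a door proof, the rows `Admissible`, `ZhUnity ∧ SlotsNondegenerate₁₃`, the (R₁₃) law chain and N11's ALL-RUNS `hT` ∕ `h11` TYPE there —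
# the Z3 TWIN of dag-n11-w1's `…N11K1WitnessGaussPinHAtZ` (its `εbg = 1` member), WITHOUT its two R-currency door theorems

Cell `pub-ymgap` (D-0062 Track A), seat `pub-ymgap-dag-n24-c` (R134 N24 [B2 composite] s2, gen 16) for the K0-AT-Z3 road (plan g91 SIZING WORD I.46176 ∕ ZB-DEPS WORD: L1 p706279 ✓ · L2 ✓ · L3 · L4 = V22-Z):
item (Z-4) of this seat's LOCATED-ZB-DEPS census (I.46522) — the K1 engine of record (p683697) reads `admissible_∕zhUnity_slotsNondegenerate₁₃_∕N13_laws₁₃CoPH_all_gaussPinH_ofHistoryBlind_theta13OfThm1CCMWZ`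
at the `εbg = 1` member; a V22-Z face needs them AT THE Z3 MEMBER `εbg := a₀`.  First refusal offered to the dag-n11-w1 lineage (I.46522; plan word: until 09:00Z).  Key K1⁹ =
stmt-QuantumFields-27364 (`--kind proof --supports 27364 --as helper`; count-neutral).  [III] = [Balaban1988Convergent], [V] = [Balaban1989LargeFieldII], [IV] = [Balaban1989LargeFieldI],
[I] = [Balaban1987RG1], [15] = [Balaban1985Variational].

WHAT.  A TOKEN-PASS of dag-n11-w1's file (`theta13OfThm1CCMWZ … ↦ theta13OfThm1CCMWZB … εbg …`, `stage12NumericsOfThm1CCMW ↦ stage12NumericsOfThm1CCMWB … εbg`, THE ONE NEW SIGN `hbg : 0 < εbg`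
(Z3 `admissible_theta13OfThm1CCMWZB_of_le_half`, `stage12NumericsOfThm1CCMWB_pos_of_le_half`), `M = L^j ≥ 1` inline; every proof the SAME one-line application of a θ-GENERIC theorem
(`antecedent_gaussPinH`, `zhUnity_of_gaussCert`, `gaussPinH_ζ0 ∕ _quad`, `rOpLeaf_VOfRecord₁₃CoPH_iff`, `sLaw₁₃CoPH_all_of_gaussCert_of_obligations_of_operandRows`, `N11_h11_of_gaussCert_of_laws`, …)
now fed by Z3's rows and this seat's Z3 free-slot rows `N24_rOpLeaf_VOfRecord₁₃CoPH_∕N24_laws₁₃CoPH_theta13OfThm1CCMWZB` (`Node00/N24ItemsStage13AtThm1CCMWZBSepCoPH`)):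
§0 `rfl` faces · §1 ★ `antecedent_gaussPinH_ofHistoryBlind_theta13OfThm1CCMWZB` (from ANY door proof `hP`, general `Zr`) · ★ `zhUnity_slotsNondegenerate₁₃_…` · ★ `admissible_…` ·
§2 `N13_rOpLeaf_∕N13_laws₁₃CoPH_∕N13_laws₁₃CoPH_all_gaussPinH_ofHistoryBlind_theta13OfThm1CCMWZB` · §3 N11's `hT` ∕ `h11` at `θᴳᶻᴮ` (token family ∕ operand-rows road).
NOT TWINNED: the Z file's `antecedent_…_of_gauge9TopStepR_of_betaBoxSignFree_allTorus_door` ∕ `provisos₁₃SepCoPH_…_door` (R-currency door over an `εbg = 1`-only `rfl`, DEF-1 I.≈46534) —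
at Z3 a door proof `hP` is produced from k0-s1 ∕ DEF-1 L3's GRID-GUARD row by the K1 engine itself.  At `εbg = 1` every theorem here IS dag-n11-w1's (Z3 bridge `theta13OfThm1CCMWZ_eq_B`, `rfl`).

HONEST FRAMING.  Helper lane of K1⁹; count-neutral KERNEL COMPOSITION of landed θ-generic theorems at DEF-1's Z3 definition edition; door proofs `hP`, supplier obligations, operand rows
are DISPLAYED HYPOTHESES where they appear; NO value of `εbg`, `E_k`, `log z_k` pinned or read; NOT a claim that any Z3 member is K1⁹'s witness; K0⁷ V21-G texts untouched; nothing of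
Bałaban asserted; K0⁷ ∕ K1⁹ NOT closed; N11 ∕ N13 NOT discharged; counts unmoved (typed 28∕28 · discharged 8∕28, 8∕27 excl. NODE O).  One finite `𝕋⁴_{L^K}` programme at fixed `ε = L^{−K}`;
R4 closes only the conditional finite-𝕋⁴ rung `BalabanLadder.UV` — NOT ℝ⁴, NOT OS, NOT a mass gap, NOT Clay.  No `sorry`, `axiom`, `def`, `instance`, `notation`.
Sources (SHAPE ∕ bookkeeping only): [III] Thm 1 p.262, (2.6)–(2.8) pp.255–256, (3.16)–(3.25) pp.268–270, (1.11) p.248, (1.15) p.249, p.244, Theorem p.245, §3 p.279; [V] Thm 1 + (0.1) pp.355–356,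
(0.15) p.360; [IV] (0.2)–(0.4) p.176, p.177 (i)–(ii); [I] Thm 1 p.255∕p.259, (0.20)–(0.21) p.256, §1 p.264; [15] Thm 1 (8)–(9) p.279.
-/

noncomputable section

open MeasureTheory
open scoped BigOperators ENNReal NNReal Matrix.Norms.L2Operator

namespace Summit.QuantumFields.YangMills.Theorems.BalabanUVNodesN11K1WitnessGaussPinHAtZB

open Literature.MathematicalPhysics.QuantumFieldTheory.Balaban1983to89 T4Continuum Node00 Node00.Tk DagBinding T4DatumAssembly FlowStepRuns AveragingRT
open FlowStep (BetaLowerH BetaUpperH)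
open B10Eq42TorusConstraint (bondsIn)
open BalabanUVNodesN11Sect3SupplyChainDefs (Sect3Supplier)
open BalabanUVNodesN11Sect3SupplyChainObligationsDefs
open BalabanUVNodesN11GaussianCertificateDefs (gaussPinH gaussPinH_ζ0 gaussPinH_quad provisos₁₃CoPH_gaussPinH antecedent_gaussPinH gaussPinH_toStage13Params)
open BalabanUVNodesN11GaussianCertificateRows (zhUnity_of_gaussCert)
open BalabanUVNodesN11Sect3SupplyChainNodeAtNumerics

variable {F : T4Family} {N : ℕ} [NeZero N]

/-! ## §0  `rfl` faces of `θᴳᶻ := gaussPinH (Stage13HParams.ofHistoryBlind F N ⟨θ₁₅ᶜᶜᴹᵂᶻ, Zr⟩)` — the Stage-13 part is the z-witness `θ₁₅ᶜᶜᴹᵂᶻ(j; γ; Efl, logz)` itself -/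

section Faces

variable (j : ℕ) (γ εbg ε₀ ε₂₉ B₃ B₃' a₀ a₁ : ℝ) (Efl logz : B12.RunParams → ℕ → ℝ) (Zr : (q : B12.RunParams) → TkResidualW F N (FluctV N) q.K)

/-- The Stage-13 part of `θᴳᶻ` IS `θ₁₅ᶜᶜᴹᵂᶻ(j; γ; Efl, logz)` (`rfl`): every `θ₁₅ᶜᶜᴹᵂᶻ`-keyed numeric, leaf and β-of-record face of dag-n24-c's Z door is unchanged under `θᴴᶻ ↦ θᴳᶻ`.
[cite: Balaban1988Convergent, (3.16) p.268, (1.15) p.249 (bookkeeping)] -/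
theorem gaussPinH_ofHistoryBlind_theta13OfThm1CCMWZB_toStage13Params :
    (gaussPinH (Stage13HParams.ofHistoryBlind F N ⟨theta13OfThm1CCMWZB F N j γ εbg ε₀ ε₂₉ B₃ B₃' a₀ a₁ Efl logz, Zr⟩)).toStage13Params =
      theta13OfThm1CCMWZB F N j γ εbg ε₀ ε₂₉ B₃ B₃' a₀ a₁ Efl logz := rfl

/-- The Stage-13R part of `θᴳᶻ` is `⟨θ₁₅ᶜᶜᴹᵂᶻ, Zr⟩` (`rfl`). [cite: Balaban1988Convergent, (3.16) p.268 (bookkeeping)] -/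
theorem gaussPinH_ofHistoryBlind_theta13OfThm1CCMWZB_toStage13RParams :
    (gaussPinH (Stage13HParams.ofHistoryBlind F N ⟨theta13OfThm1CCMWZB F N j γ εbg ε₀ ε₂₉ B₃ B₃' a₀ a₁ Efl logz, Zr⟩)).toStage13RParams =
      ⟨theta13OfThm1CCMWZB F N j γ εbg ε₀ ε₂₉ B₃ B₃' a₀ a₁ Efl logz, Zr⟩ := rfl

/-- The β of record read by the K1 run rows ∕ box letters is unchanged under `θᴴᶻ ↦ θᴳᶻ` (`rfl`) — and it is the BLIND β (Z2 `betaOfRecord₁₃` is E-free).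
[cite: Balaban1987RG1, (1.20)–(1.22) p.264 (bookkeeping)] -/
theorem betaOfRecord₁₃_gaussPinH_ofHistoryBlind_theta13OfThm1CCMWZB :
    betaOfRecord₁₃ F N (gaussPinH (Stage13HParams.ofHistoryBlind F N ⟨theta13OfThm1CCMWZB F N j γ εbg ε₀ ε₂₉ B₃ B₃' a₀ a₁ Efl logz, Zr⟩)).toStage13Params =
      betaOfRecord₁₃ F N (theta13OfThm1CCMWZB F N j γ εbg ε₀ ε₂₉ B₃ B₃' a₀ a₁ Efl logz) := rfl

/-- `θᴳᶻ` IS the free-residual-slots tuple `⟨⟨θ₁₅ᶜᶜᴹᵂᶻ, Zr⟩, θᴳᶻ.Zh, θᴳᶻ.Phih⟩` (`rfl`), so every free-slot theorem of dag-n24-c's Z door §0 instantiates at `θᴳᶻ`.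
[cite: Balaban1988Convergent, (3.16)–(3.20) pp.268–269 (bookkeeping)] -/
theorem gaussPinH_ofHistoryBlind_theta13OfThm1CCMWZB_eq_tuple :
    gaussPinH (Stage13HParams.ofHistoryBlind F N ⟨theta13OfThm1CCMWZB F N j γ εbg ε₀ ε₂₉ B₃ B₃' a₀ a₁ Efl logz, Zr⟩) =
      (⟨⟨theta13OfThm1CCMWZB F N j γ εbg ε₀ ε₂₉ B₃ B₃' a₀ a₁ Efl logz, Zr⟩,
        (gaussPinH (Stage13HParams.ofHistoryBlind F N ⟨theta13OfThm1CCMWZB F N j γ εbg ε₀ ε₂₉ B₃ B₃' a₀ a₁ Efl logz, Zr⟩)).Zh,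
        (gaussPinH (Stage13HParams.ofHistoryBlind F N ⟨theta13OfThm1CCMWZB F N j γ εbg ε₀ ε₂₉ B₃ B₃' a₀ a₁ Efl logz, Zr⟩)).Phih⟩ : Stage13HParams F N) := rfl

end Faces

/-! ## §1  K⁰'s ANTECEDENT ∕ THE FOUR DOOR ROWS AT `θᴳᶻ`: from any door proof at `θᴴᶻ` (general `Zr`), and keyed on dag-n24-c's Z door letters (`Zr := ZrOfRecord₁₃ F N θ₁₅ᶜᶜᴹᵂᶻ`) -/

section Antecedent

variable {j : ℕ} {γ εbg ε₀ ε₂₉ B₃ B₃' a₀ a₁ : ℝ} {Efl logz : B12.RunParams → ℕ → ℝ}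

/-- **★ K⁰'s ANTECEDENT AT `θᴳᶻ` FROM ANY DOOR PROOF AT `θᴴᶻ`** (general run-indexed residual `Zr`): `Provisos₁₃SepCoPH ∧ (ZhUnity ∧ SlotsNondegenerate₁₃) ∧ Admissible` at
`gaussPinH (ofHistoryBlind ⟨θ₁₅ᶜᶜᴹᵂᶻ, Zr⟩)` from `hP` (this seat's `antecedent_gaussPinH`: `ZhUnity` UNCONDITIONAL at the certificate; non-degeneracy and admissibility read the Stage-13
part only — Z2's `slotsNondegenerate₁₃_theta13OfThm1CCMWZB`, `admissible_theta13OfThm1CCMWZB_of_le_half` from the window `0 < γ ≤ ½` + six signs, WHATEVER THE LETTERS).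
[cite: Balaban1988Convergent, Thm 1 p.262, (2.6)–(2.8) pp.255–256, (3.16)–(3.22) pp.268–269, (1.15) p.249; Balaban1987RG1, Thm 1 p.259; Balaban1989LargeFieldII, (0.15) p.360; Balaban1989LargeFieldI, (0.2)–(0.4) p.176 (bookkeeping)] -/
theorem antecedent_gaussPinH_ofHistoryBlind_theta13OfThm1CCMWZB (hγ₀ : 0 < γ) (hγh : γ ≤ 1 / 2) (hbg : 0 < εbg) (hε : 0 < ε₀) (hε' : 0 < ε₂₉) (hB : 0 ≤ B₃) (hB' : 0 ≤ B₃')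
    (ha₀ : 0 < a₀) (ha₁ : 0 < a₁) (Zr : (q : B12.RunParams) → TkResidualW F N (FluctV N) q.K)
    (hP : (Stage13HParams.ofHistoryBlind F N ⟨theta13OfThm1CCMWZB F N j γ εbg ε₀ ε₂₉ B₃ B₃' a₀ a₁ Efl logz, Zr⟩).Provisos₁₃SepCoPH F N) :
    (gaussPinH (Stage13HParams.ofHistoryBlind F N ⟨theta13OfThm1CCMWZB F N j γ εbg ε₀ ε₂₉ B₃ B₃' a₀ a₁ Efl logz, Zr⟩)).Provisos₁₃SepCoPH F N ∧
      ((gaussPinH (Stage13HParams.ofHistoryBlind F N ⟨theta13OfThm1CCMWZB F N j γ εbg ε₀ ε₂₉ B₃ B₃' a₀ a₁ Efl logz, Zr⟩)).ZhUnity F N ∧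
        (gaussPinH (Stage13HParams.ofHistoryBlind F N ⟨theta13OfThm1CCMWZB F N j γ εbg ε₀ ε₂₉ B₃ B₃' a₀ a₁ Efl logz, Zr⟩)).SlotsNondegenerate₁₃ F N) ∧
      (gaussPinH (Stage13HParams.ofHistoryBlind F N ⟨theta13OfThm1CCMWZB F N j γ εbg ε₀ ε₂₉ B₃ B₃' a₀ a₁ Efl logz, Zr⟩)).Admissible F N :=
  antecedent_gaussPinH hP (slotsNondegenerate₁₃_theta13OfThm1CCMWZB F N j γ εbg ε₀ ε₂₉ B₃ B₃' a₀ a₁ Efl logz)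
    (admissible_theta13OfThm1CCMWZB_of_le_half F N Efl logz hγ₀ hγh hbg hε hε' hB hB' ha₀ ha₁)

/-- **★ The unity ∧ non-degeneracy guard at `θᴳᶻ` — UNCONDITIONAL** (the `hU` slot at `θ := θᴳᶻ`; general `Zr`; letters NOT read).
[cite: Balaban1988Convergent, (1.11) p.248, (3.16)–(3.22) pp.268–269; Balaban1989LargeFieldI, (0.2)–(0.3) p.176 (bookkeeping)] -/
theorem zhUnity_slotsNondegenerate₁₃_gaussPinH_ofHistoryBlind_theta13OfThm1CCMWZB (Zr : (q : B12.RunParams) → TkResidualW F N (FluctV N) q.K) :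
    (gaussPinH (Stage13HParams.ofHistoryBlind F N ⟨theta13OfThm1CCMWZB F N j γ εbg ε₀ ε₂₉ B₃ B₃' a₀ a₁ Efl logz, Zr⟩)).ZhUnity F N ∧
      (gaussPinH (Stage13HParams.ofHistoryBlind F N ⟨theta13OfThm1CCMWZB F N j γ εbg ε₀ ε₂₉ B₃ B₃' a₀ a₁ Efl logz, Zr⟩)).SlotsNondegenerate₁₃ F N :=
  ⟨zhUnity_of_gaussCert _ (gaussPinH_ζ0 _), slotsNondegenerate₁₃_theta13OfThm1CCMWZB F N j γ εbg ε₀ ε₂₉ B₃ B₃' a₀ a₁ Efl logz⟩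

/-- **★ Admissibility at `θᴳᶻ`** from the window + six signs, WHATEVER THE LETTERS (the `hθ` slot at `θ := θᴳᶻ`; general `Zr`).
[cite: Balaban1988Convergent, (2.6)–(2.8) pp.255–256, (2.10) p.256; Balaban1987RG1, Thm 1 p.259; Balaban1989LargeFieldI, (0.4) p.176 (bookkeeping)] -/
theorem admissible_gaussPinH_ofHistoryBlind_theta13OfThm1CCMWZB (hγ₀ : 0 < γ) (hγh : γ ≤ 1 / 2) (hbg : 0 < εbg) (hε : 0 < ε₀) (hε' : 0 < ε₂₉) (hB : 0 ≤ B₃) (hB' : 0 ≤ B₃')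
    (ha₀ : 0 < a₀) (ha₁ : 0 < a₁) (Zr : (q : B12.RunParams) → TkResidualW F N (FluctV N) q.K) :
    (gaussPinH (Stage13HParams.ofHistoryBlind F N ⟨theta13OfThm1CCMWZB F N j γ εbg ε₀ ε₂₉ B₃ B₃' a₀ a₁ Efl logz, Zr⟩)).Admissible F N :=
  admissible_theta13OfThm1CCMWZB_of_le_half F N Efl logz hγ₀ hγh hbg hε hε' hB hB' ha₀ ha₁

end Antecedent

/-! ## §2  N13's CoPH 𝐑-leaf and the (R₁₃) law chain at `θᴳᶻ` (the `hlaws` door row) — dag-n24-c's free-slot Z rows read at `θᴳᶻ`'s own slots -/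

section RLeaf

variable {j : ℕ} {γ εbg ε₀ ε₂₉ B₃ B₃' a₀ a₁ : ℝ} {Efl logz : B12.RunParams → ℕ → ℝ} (Zr : (q : B12.RunParams) → TkResidualW F N (FluctV N) q.K) (p : B12.RunParams)

/-- **★ N13's CoPH 𝐑-leaf at `θᴳᶻ`**: `ROpLeaf (VOfRecord₁₃CoPH F N θᴳᶻ p)` from the window `0 < γ ≤ ½` and the six admissibility signs — dag-n24-c's free-slot
`N24_rOpLeaf_VOfRecord₁₃CoPH_theta13OfThm1CCMWZB` at the slots `(Zr, θᴳᶻ.Zh, θᴳᶻ.Phih)` (§0 `…_eq_tuple`).  NO [15] fact, NO `bg`, letters NOT read.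
[cite: Balaban1988Convergent, p.244, (3.16) p.268; Balaban1989LargeFieldI, (0.3)–(0.4) p.176, p.177 (i)–(ii); Balaban1989LargeFieldII, Thm 1 p.355 (not exercised); Balaban1987RG1, Thm 1 p.255, §1 p.264 (window)] -/
theorem N13_rOpLeaf_VOfRecord₁₃CoPH_gaussPinH_ofHistoryBlind_theta13OfThm1CCMWZB (hγ₀ : 0 < γ) (hγh : γ ≤ 1 / 2) (hbg : 0 < εbg) (hε : 0 < ε₀) (hε' : 0 < ε₂₉) (hB : 0 ≤ B₃)
    (hB' : 0 ≤ B₃') (ha₀ : 0 < a₀) (ha₁ : 0 < a₁) :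
    ROpLeaf (VOfRecord₁₃CoPH F N (gaussPinH (Stage13HParams.ofHistoryBlind F N ⟨theta13OfThm1CCMWZB F N j γ εbg ε₀ ε₂₉ B₃ B₃' a₀ a₁ Efl logz, Zr⟩)) p) :=
  N24_rOpLeaf_VOfRecord₁₃CoPH_theta13OfThm1CCMWZB Zr
    (gaussPinH (Stage13HParams.ofHistoryBlind F N ⟨theta13OfThm1CCMWZB F N j γ εbg ε₀ ε₂₉ B₃ B₃' a₀ a₁ Efl logz, Zr⟩)).Zh
    (gaussPinH (Stage13HParams.ofHistoryBlind F N ⟨theta13OfThm1CCMWZB F N j γ εbg ε₀ ε₂₉ B₃ B₃' a₀ a₁ Efl logz, Zr⟩)).Phih p hγ₀ hγh hbg hε hε' hB hB' ha₀ ha₁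

/-- **★ N13's (R₁₃) slot in law form at `θᴳᶻ`**: `∀ k < K, TLaw₁₃CoPH θᴳᶻ p k → SLaw₁₃CoPH θᴳᶻ p (k+1)` from the window and the six signs (dag-n24-c's free-slot
`N24_laws₁₃CoPH_theta13OfThm1CCMWZB` at `θᴳᶻ`'s slots). [cite: Balaban1988Convergent, p.244 (bookkeeping); Balaban1989LargeFieldI, (0.3)–(0.4) p.176; Balaban1989LargeFieldII, Thm 1 p.355 (not exercised)] -/
theorem N13_laws₁₃CoPH_gaussPinH_ofHistoryBlind_theta13OfThm1CCMWZB (hγ₀ : 0 < γ) (hγh : γ ≤ 1 / 2) (hbg : 0 < εbg) (hε : 0 < ε₀) (hε' : 0 < ε₂₉) (hB : 0 ≤ B₃) (hB' : 0 ≤ B₃')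
    (ha₀ : 0 < a₀) (ha₁ : 0 < a₁) :
    ∀ k, k < p.K →
      TLaw₁₃CoPH F N (gaussPinH (Stage13HParams.ofHistoryBlind F N ⟨theta13OfThm1CCMWZB F N j γ εbg ε₀ ε₂₉ B₃ B₃' a₀ a₁ Efl logz, Zr⟩)) p k →
        SLaw₁₃CoPH F N (gaussPinH (Stage13HParams.ofHistoryBlind F N ⟨theta13OfThm1CCMWZB F N j γ εbg ε₀ ε₂₉ B₃ B₃' a₀ a₁ Efl logz, Zr⟩)) p (k + 1) :=
  N24_laws₁₃CoPH_theta13OfThm1CCMWZB Zr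
    (gaussPinH (Stage13HParams.ofHistoryBlind F N ⟨theta13OfThm1CCMWZB F N j γ εbg ε₀ ε₂₉ B₃ B₃' a₀ a₁ Efl logz, Zr⟩)).Zh
    (gaussPinH (Stage13HParams.ofHistoryBlind F N ⟨theta13OfThm1CCMWZB F N j γ εbg ε₀ ε₂₉ B₃ B₃' a₀ a₁ Efl logz, Zr⟩)).Phih p hγ₀ hγh hbg hε hε' hB hB' ha₀ ha₁

/-- **★★ N13's (R₁₃) slot at `θᴳᶻ` for ALL runs at once** — the literal `hlaws` door-row shape `∀ P k, k < P.K → TLaw → SLaw (k+1)` of dag-n24-c's `…_byName_atWitness` at `θ := θᴳᶻ`.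
[cite: Balaban1988Convergent, p.244 (bookkeeping); Balaban1989LargeFieldII, Thm 1 p.355 (not exercised)] -/
theorem N13_laws₁₃CoPH_all_gaussPinH_ofHistoryBlind_theta13OfThm1CCMWZB (hγ₀ : 0 < γ) (hγh : γ ≤ 1 / 2) (hbg : 0 < εbg) (hε : 0 < ε₀) (hε' : 0 < ε₂₉) (hB : 0 ≤ B₃)
    (hB' : 0 ≤ B₃') (ha₀ : 0 < a₀) (ha₁ : 0 < a₁) :
    ∀ (P : B12.RunParams) (k : ℕ), k < P.K →
      TLaw₁₃CoPH F N (gaussPinH (Stage13HParams.ofHistoryBlind F N ⟨theta13OfThm1CCMWZB F N j γ εbg ε₀ ε₂₉ B₃ B₃' a₀ a₁ Efl logz, Zr⟩)) P k →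
        SLaw₁₃CoPH F N (gaussPinH (Stage13HParams.ofHistoryBlind F N ⟨theta13OfThm1CCMWZB F N j γ εbg ε₀ ε₂₉ B₃ B₃' a₀ a₁ Efl logz, Zr⟩)) P (k + 1) :=
  fun P => N13_laws₁₃CoPH_gaussPinH_ofHistoryBlind_theta13OfThm1CCMWZB Zr P hγ₀ hγh hbg hε hε' hB hB' ha₀ ha₁

end RLeaf

/-! ## §3  N11's ALL-RUNS `hT` binder, Theorem 1 and the `h11` TYPE at `θᴳᶻ` — from `hrec` + a token per run, resp. `SupplierObligations` + `OperandRowsAlongChain`, nothing else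
(`θᴳᶻ.toStage13Params = θ₁₅ᶜᶜᴹᵂᶻ = (theta13OfNumericsZ …).liveRepin₁₃`, `rfl`; the WINDOWED editions are this seat's `…TokensAtZWitness` §3) -/

section N11Side

variable {j : ℕ} {γ εbg ε₀ ε₂₉ B₃ B₃' a₀ a₁ : ℝ} {Efl logz : B12.RunParams → ℕ → ℝ} (Zr : (q : B12.RunParams) → TkResidualW F N (FluctV N) q.K)

/-- **★★ N11's ALL-RUNS `hT` BINDER AT `θᴳᶻ` FROM A TOKEN PER RUN**: `∀ P k, k < P.K → SLaw₁₃CoPH θᴳᶻ P k → TLaw₁₃CoPH θᴳᶻ P k` from `hrec` (the door core) and N11's one-token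
residual `∀ P, SupplyChainAt θᴳᶻ P` (this seat's θ-generic `thmP245Laws_all_liveRepinH_of_supplyChainAt` at `θ₀ := theta13OfNumericsZ …`, Z2's `admissible_theta13OfNumericsZ`; numerals
`κ = 2·10⁴`, `E₀ = B₀ = 1`, `M = L^j ≥ 1`).  CONDITIONAL; N11 NOT discharged. [cite: Balaban1988Convergent, Theorem p.245, Thm 1 p.262, remark p.262, §3 p.279, (3.23)–(3.25) p.270, (1.15) p.249; Balaban1987RG1, Thm 1 p.259; Balaban1989LargeFieldII, (0.15) p.360; Balaban1989LargeFieldI, (0.2)–(0.4) p.176] -/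
theorem hT_gaussPinH_ofHistoryBlind_theta13OfThm1CCMWZB_of_supplyChainAt (hγ₀ : 0 < γ) (hγh : γ ≤ 1 / 2) (hbg : 0 < εbg) (hε : 0 < ε₀) (hε' : 0 < ε₂₉)
    (hB : 0 ≤ B₃) (hB' : 0 ≤ B₃') (ha₀ : 0 < a₀) (ha₁ : 0 < a₁)
    (hrec : (gaussPinH (Stage13HParams.ofHistoryBlind F N ⟨theta13OfThm1CCMWZB F N j γ εbg ε₀ ε₂₉ B₃ B₃' a₀ a₁ Efl logz, Zr⟩)).Provisos₁₃CoPH F N)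
    (hN : ∀ P : B12.RunParams, SupplyChainAt (gaussPinH (Stage13HParams.ofHistoryBlind F N ⟨theta13OfThm1CCMWZB F N j γ εbg ε₀ ε₂₉ B₃ B₃' a₀ a₁ Efl logz, Zr⟩)) P) :
    ∀ (P : B12.RunParams) (k : ℕ), k < P.K →
      SLaw₁₃CoPH F N (gaussPinH (Stage13HParams.ofHistoryBlind F N ⟨theta13OfThm1CCMWZB F N j γ εbg ε₀ ε₂₉ B₃ B₃' a₀ a₁ Efl logz, Zr⟩)) P k →
        TLaw₁₃CoPH F N (gaussPinH (Stage13HParams.ofHistoryBlind F N ⟨theta13OfThm1CCMWZB F N j γ εbg ε₀ ε₂₉ B₃ B₃' a₀ a₁ Efl logz, Zr⟩)) P k :=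
  thmP245Laws_all_liveRepinH_of_supplyChainAt (θ := gaussPinH (Stage13HParams.ofHistoryBlind F N ⟨theta13OfThm1CCMWZB F N j γ εbg ε₀ ε₂₉ B₃ B₃' a₀ a₁ Efl logz, Zr⟩))
    (θ₀ := theta13OfNumericsZ F N (stage12NumericsOfThm1CCMWB F.L j γ εbg ε₀ B₃ B₃' a₀ a₁) ε₂₉
      (zeta316OfRecord F N (stage12NumericsOfThm1CCMWB F.L j γ εbg ε₀ B₃ B₃' a₀ a₁).ν (stage12NumericsOfThm1CCMWB F.L j γ εbg ε₀ B₃ B₃' a₀ a₁).τ9.M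
        (stage12NumericsOfThm1CCMWB F.L j γ εbg ε₀ B₃ B₃' a₀ a₁).A₁) (RzOfRecord F N) (ZtOfRecord F N) Efl logz)
    rfl (admissible_theta13OfNumericsZ F N _ _ _ Efl logz (stage12NumericsOfThm1CCMWB_pos_of_le_half F.hL.2.le hγ₀ hγh hbg hε hB hB' ha₀ ha₁) hε')
    (by rw [theta13OfNumericsZ_s2, show (stage12NumericsOfThm1CCMWB F.L j γ εbg ε₀ B₃ B₃' a₀ a₁).s2.lf.κ = 20000 from rfl]; norm_num)
    (by rw [theta13OfNumericsZ_s2, show (stage12NumericsOfThm1CCMWB F.L j γ εbg ε₀ B₃ B₃' a₀ a₁).s2.lf.E₀ = 1 from rfl]; norm_num)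
    (by rw [theta13OfNumericsZ_s2, show (stage12NumericsOfThm1CCMWB F.L j γ εbg ε₀ B₃ B₃' a₀ a₁).s2.lf.B₀ = 1 from rfl]; norm_num)
    (by show 1 ≤ F.L ^ j; exact Nat.one_le_pow _ _ (by have := F.hL11; omega)) hrec hN

/-- **★★★ N11's ALL-RUNS `hT` BINDER AT `θᴳᶻ` FROM `hrec` + `SupplierObligations` + `OperandRowsAlongChain`** — the no-expansion half of `SupplyChainAt` DISCHARGED in the
Gaussian-certificate class (dag-n11-e's `noExpansionObligation_of_gaussCert_of_operandRows`; the keys `gaussPinH_ζ0 ∕ _quad` are `rfl`), per run; window + six signs; letters NOT read.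
dag-n11-w6 §2's `hT_…` at the z-witness.  CONDITIONAL; N11 NOT discharged; K1⁹ NOT closed. [cite: Balaban1988Convergent, Theorem p.245, Thm 1 p.262, remark p.262, §3 p.279, (3.16)–(3.25) pp.268–270, (2.21) p.258, (1.15) p.249; Balaban1987RG1, Thm 1 p.259; Balaban1989LargeFieldII, (0.15) p.360; Balaban1989LargeFieldI, (0.2)–(0.4) p.176] -/
theorem hT_gaussPinH_ofHistoryBlind_theta13OfThm1CCMWZB_of_obligations_of_operandRows (hγ₀ : 0 < γ) (hγh : γ ≤ 1 / 2) (hbg : 0 < εbg) (hε : 0 < ε₀) (hε' : 0 < ε₂₉)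
    (hB : 0 ≤ B₃) (hB' : 0 ≤ B₃') (ha₀ : 0 < a₀) (ha₁ : 0 < a₁)
    (hrec : (gaussPinH (Stage13HParams.ofHistoryBlind F N ⟨theta13OfThm1CCMWZB F N j γ εbg ε₀ ε₂₉ B₃ B₃' a₀ a₁ Efl logz, Zr⟩)).Provisos₁₃CoPH F N)
    (σ : (P : B12.RunParams) → Sect3Supplier (gaussPinH (Stage13HParams.ofHistoryBlind F N ⟨theta13OfThm1CCMWZB F N j γ εbg ε₀ ε₂₉ B₃ B₃' a₀ a₁ Efl logz, Zr⟩)) P)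
    (hσ : ∀ P, SupplierObligations (gaussPinH (Stage13HParams.ofHistoryBlind F N ⟨theta13OfThm1CCMWZB F N j γ εbg ε₀ ε₂₉ B₃ B₃' a₀ a₁ Efl logz, Zr⟩)) P (σ P))
    (hops : ∀ P, OperandRowsAlongChain (gaussPinH (Stage13HParams.ofHistoryBlind F N ⟨theta13OfThm1CCMWZB F N j γ εbg ε₀ ε₂₉ B₃ B₃' a₀ a₁ Efl logz, Zr⟩)) P (σ P)) :
    ∀ (P : B12.RunParams) (k : ℕ), k < P.K →
      SLaw₁₃CoPH F N (gaussPinH (Stage13HParams.ofHistoryBlind F N ⟨theta13OfThm1CCMWZB F N j γ εbg ε₀ ε₂₉ B₃ B₃' a₀ a₁ Efl logz, Zr⟩)) P k →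
        TLaw₁₃CoPH F N (gaussPinH (Stage13HParams.ofHistoryBlind F N ⟨theta13OfThm1CCMWZB F N j γ εbg ε₀ ε₂₉ B₃ B₃' a₀ a₁ Efl logz, Zr⟩)) P k :=
  hT_gaussPinH_ofHistoryBlind_theta13OfThm1CCMWZB_of_supplyChainAt Zr hγ₀ hγh hbg hε hε' hB hB' ha₀ ha₁ hrec fun P =>
    ⟨σ P, hσ P, noExpansionObligation_of_gaussCert_of_operandRows (gaussPinH_ζ0 _) (gaussPinH_quad _) hrec
      (by show 1 ≤ F.L ^ j; exact Nat.one_le_pow _ _ (by have := F.hL11; omega)) (σ P) (hσ P).loc (hops P)⟩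

/-- **★★ THEOREM 1 OF [III], ALL LEVELS `k ≤ K`, AT `θᴳᶻ`** from `hrec` + a supplier with its obligations + def-T's operand rows (this seat's θ-generic
`sLaw₁₃CoPH_all_liveRepinH_gaussCert_of_obligations_of_operandRows` at `θ₀ := theta13OfNumericsZ …`).  CONDITIONAL; letters NOT read. [cite: Balaban1988Convergent, Thm 1 p.262, Theorem p.245, (3.16)–(3.25) pp.268–270, (2.21) p.258, (1.11) p.248, (1.15) p.249; Balaban1987RG1, Thm 1 p.259; Balaban1989LargeFieldII, (0.15) p.360; Balaban1989LargeFieldI, (0.2)–(0.4) p.176] -/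
theorem sLaw₁₃CoPH_all_gaussPinH_ofHistoryBlind_theta13OfThm1CCMWZB_of_obligations_of_operandRows {p : B12.RunParams} (hγ₀ : 0 < γ) (hγh : γ ≤ 1 / 2) (hbg : 0 < εbg)
    (hε : 0 < ε₀) (hε' : 0 < ε₂₉) (hB : 0 ≤ B₃) (hB' : 0 ≤ B₃') (ha₀ : 0 < a₀) (ha₁ : 0 < a₁)
    (hrec : (gaussPinH (Stage13HParams.ofHistoryBlind F N ⟨theta13OfThm1CCMWZB F N j γ εbg ε₀ ε₂₉ B₃ B₃' a₀ a₁ Efl logz, Zr⟩)).Provisos₁₃CoPH F N)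
    (σ : Sect3Supplier (gaussPinH (Stage13HParams.ofHistoryBlind F N ⟨theta13OfThm1CCMWZB F N j γ εbg ε₀ ε₂₉ B₃ B₃' a₀ a₁ Efl logz, Zr⟩)) p)
    (hσ : SupplierObligations (gaussPinH (Stage13HParams.ofHistoryBlind F N ⟨theta13OfThm1CCMWZB F N j γ εbg ε₀ ε₂₉ B₃ B₃' a₀ a₁ Efl logz, Zr⟩)) p σ)
    (hops : OperandRowsAlongChain (gaussPinH (Stage13HParams.ofHistoryBlind F N ⟨theta13OfThm1CCMWZB F N j γ εbg ε₀ ε₂₉ B₃ B₃' a₀ a₁ Efl logz, Zr⟩)) p σ) :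
    ∀ k, k ≤ p.K → SLaw₁₃CoPH F N (gaussPinH (Stage13HParams.ofHistoryBlind F N ⟨theta13OfThm1CCMWZB F N j γ εbg ε₀ ε₂₉ B₃ B₃' a₀ a₁ Efl logz, Zr⟩)) p k :=
  sLaw₁₃CoPH_all_liveRepinH_gaussCert_of_obligations_of_operandRows (θ := gaussPinH (Stage13HParams.ofHistoryBlind F N ⟨theta13OfThm1CCMWZB F N j γ εbg ε₀ ε₂₉ B₃ B₃' a₀ a₁ Efl logz, Zr⟩))
    (θ₀ := theta13OfNumericsZ F N (stage12NumericsOfThm1CCMWB F.L j γ εbg ε₀ B₃ B₃' a₀ a₁) ε₂₉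
      (zeta316OfRecord F N (stage12NumericsOfThm1CCMWB F.L j γ εbg ε₀ B₃ B₃' a₀ a₁).ν (stage12NumericsOfThm1CCMWB F.L j γ εbg ε₀ B₃ B₃' a₀ a₁).τ9.M
        (stage12NumericsOfThm1CCMWB F.L j γ εbg ε₀ B₃ B₃' a₀ a₁).A₁) (RzOfRecord F N) (ZtOfRecord F N) Efl logz)
    rfl (admissible_theta13OfNumericsZ F N _ _ _ Efl logz (stage12NumericsOfThm1CCMWB_pos_of_le_half F.hL.2.le hγ₀ hγh hbg hε hB hB' ha₀ ha₁) hε')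
    (by rw [theta13OfNumericsZ_s2, show (stage12NumericsOfThm1CCMWB F.L j γ εbg ε₀ B₃ B₃' a₀ a₁).s2.lf.κ = 20000 from rfl]; norm_num)
    (by rw [theta13OfNumericsZ_s2, show (stage12NumericsOfThm1CCMWB F.L j γ εbg ε₀ B₃ B₃' a₀ a₁).s2.lf.E₀ = 1 from rfl]; norm_num)
    (by rw [theta13OfNumericsZ_s2, show (stage12NumericsOfThm1CCMWB F.L j γ εbg ε₀ B₃ B₃' a₀ a₁).s2.lf.B₀ = 1 from rfl]; norm_num)
    (by show 1 ≤ F.L ^ j; exact Nat.one_le_pow _ _ (by have := F.hL11; omega)) (gaussPinH_ζ0 _) (gaussPinH_quad _) hrec σ hσ hops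

/-- **N11's TYPE `h11` AT `θᴳᶻ`'s SepCoPH DATUM IN dag-n24-c's `…_byName_atWitness` SHAPE FROM THE ALL-RUNS `hT` BINDER** (the world, its letters `(βup, β₀, γ)` and the leaf
antecedents are NOT read — `γ₁₁ := 1`; ANY door proof `hG` keys the datum; dag-n11-w6 §2's packaging at the z-witness).  CONDITIONAL on `hT`; N11 NOT discharged.
[cite: Balaban1988Convergent, Theorem p.245, Thm 1 p.262, remark p.262, (3.24)–(3.25) p.270; Balaban1989LargeFieldII, Thm 1 p.355 (bookkeeping)] -/
theorem N11_h11_gaussPinH_ofHistoryBlind_theta13OfThm1CCMWZB_of_laws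
    (hG : (gaussPinH (Stage13HParams.ofHistoryBlind F N ⟨theta13OfThm1CCMWZB F N j γ εbg ε₀ ε₂₉ B₃ B₃' a₀ a₁ Efl logz, Zr⟩)).Provisos₁₃SepCoPH F N)
    (hT : ∀ (P : B12.RunParams) (k : ℕ), k < P.K →
      SLaw₁₃CoPH F N (gaussPinH (Stage13HParams.ofHistoryBlind F N ⟨theta13OfThm1CCMWZB F N j γ εbg ε₀ ε₂₉ B₃ B₃' a₀ a₁ Efl logz, Zr⟩)) P k →
        TLaw₁₃CoPH F N (gaussPinH (Stage13HParams.ofHistoryBlind F N ⟨theta13OfThm1CCMWZB F N j γ εbg ε₀ ε₂₉ B₃ B₃' a₀ a₁ Efl logz, Zr⟩)) P k) :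
    ∀ βup β₀ : ℝ, ∃ γ₁₁ : ℝ, 0 < γ₁₁ ∧ ∀ w : WorldP,
      w.C = (datumOfRecord₁₃SepCoPH F N (gaussPinH (Stage13HParams.ofHistoryBlind F N ⟨theta13OfThm1CCMWZB F N j γ εbg ε₀ ε₂₉ B₃ B₃' a₀ a₁ Efl logz, Zr⟩)) hG).C →
      w.βup = βup → w.β₀ = β₀ → w.γ ≤ γ₁₁ → ∀ P : B12.RunParams, (leavesP w P).b7 → (leavesP w P).b8 → (leavesP w P).b9 → (leavesP w P).b10 → (leavesP w P).b11 →
      (leavesP w P).smallCouplings → (leavesP w P).smallFieldInductive → (leavesP w P).flowControl →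
        ∀ k, k < P.K → SLaw₁₃CoPH F N (gaussPinH (Stage13HParams.ofHistoryBlind F N ⟨theta13OfThm1CCMWZB F N j γ εbg ε₀ ε₂₉ B₃ B₃' a₀ a₁ Efl logz, Zr⟩)) P k →
          TLaw₁₃CoPH F N (gaussPinH (Stage13HParams.ofHistoryBlind F N ⟨theta13OfThm1CCMWZB F N j γ εbg ε₀ ε₂₉ B₃ B₃' a₀ a₁ Efl logz, Zr⟩)) P k :=
  fun _ _ => ⟨1, one_pos, fun _ _ _ _ _ P _ _ _ _ _ _ _ _ k hk hS => hT P k hk hS⟩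

/-- **★★★ N11's TYPE `h11` AT `θᴳᶻ`'s SepCoPH DATUM FROM `hrec` + `SupplierObligations` + `OperandRowsAlongChain`** (the supplier for the switch `θᴴᶻ ↦ θᴳᶻ` of a K1 Z closer's N11
binder: §3's `hT` through the previous theorem; general `Zr`, any door proof `hG`).  CONDITIONAL; N11 NOT discharged; K1⁹ NOT closed. [cite: Balaban1988Convergent, Theorem p.245, Thm 1 p.262, remark p.262, §3 p.279, (3.23)–(3.25) p.270, (2.21) p.258, (1.15) p.249; Balaban1987RG1, Thm 1 p.259; Balaban1989LargeFieldI, (0.2)–(0.4) p.176; Balaban1989LargeFieldII, Thm 1 p.355, (0.15) p.360 (bookkeeping)] -/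
theorem N11_h11_gaussPinH_ofHistoryBlind_theta13OfThm1CCMWZB_of_obligations_of_operandRows (hγ₀ : 0 < γ) (hγh : γ ≤ 1 / 2) (hbg : 0 < εbg) (hε : 0 < ε₀) (hε' : 0 < ε₂₉)
    (hB : 0 ≤ B₃) (hB' : 0 ≤ B₃') (ha₀ : 0 < a₀) (ha₁ : 0 < a₁)
    (hG : (gaussPinH (Stage13HParams.ofHistoryBlind F N ⟨theta13OfThm1CCMWZB F N j γ εbg ε₀ ε₂₉ B₃ B₃' a₀ a₁ Efl logz, Zr⟩)).Provisos₁₃SepCoPH F N)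
    (σ : (P : B12.RunParams) → Sect3Supplier (gaussPinH (Stage13HParams.ofHistoryBlind F N ⟨theta13OfThm1CCMWZB F N j γ εbg ε₀ ε₂₉ B₃ B₃' a₀ a₁ Efl logz, Zr⟩)) P)
    (hσ : ∀ P, SupplierObligations (gaussPinH (Stage13HParams.ofHistoryBlind F N ⟨theta13OfThm1CCMWZB F N j γ εbg ε₀ ε₂₉ B₃ B₃' a₀ a₁ Efl logz, Zr⟩)) P (σ P))
    (hops : ∀ P, OperandRowsAlongChain (gaussPinH (Stage13HParams.ofHistoryBlind F N ⟨theta13OfThm1CCMWZB F N j γ εbg ε₀ ε₂₉ B₃ B₃' a₀ a₁ Efl logz, Zr⟩)) P (σ P)) :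
    ∀ βup β₀ : ℝ, ∃ γ₁₁ : ℝ, 0 < γ₁₁ ∧ ∀ w : WorldP,
      w.C = (datumOfRecord₁₃SepCoPH F N (gaussPinH (Stage13HParams.ofHistoryBlind F N ⟨theta13OfThm1CCMWZB F N j γ εbg ε₀ ε₂₉ B₃ B₃' a₀ a₁ Efl logz, Zr⟩)) hG).C →
      w.βup = βup → w.β₀ = β₀ → w.γ ≤ γ₁₁ → ∀ P : B12.RunParams, (leavesP w P).b7 → (leavesP w P).b8 → (leavesP w P).b9 → (leavesP w P).b10 → (leavesP w P).b11 →
      (leavesP w P).smallCouplings → (leavesP w P).smallFieldInductive → (leavesP w P).flowControl →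
        ∀ k, k < P.K → SLaw₁₃CoPH F N (gaussPinH (Stage13HParams.ofHistoryBlind F N ⟨theta13OfThm1CCMWZB F N j γ εbg ε₀ ε₂₉ B₃ B₃' a₀ a₁ Efl logz, Zr⟩)) P k →
          TLaw₁₃CoPH F N (gaussPinH (Stage13HParams.ofHistoryBlind F N ⟨theta13OfThm1CCMWZB F N j γ εbg ε₀ ε₂₉ B₃ B₃' a₀ a₁ Efl logz, Zr⟩)) P k :=
  N11_h11_gaussPinH_ofHistoryBlind_theta13OfThm1CCMWZB_of_laws Zr hG
    (hT_gaussPinH_ofHistoryBlind_theta13OfThm1CCMWZB_of_obligations_of_operandRows Zr hγ₀ hγh hbg hε hε' hB hB' ha₀ ha₁ hG.toCore σ hσ hops)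

end N11Side

end Summit.QuantumFields.YangMills.Theorems.BalabanUVNodesN11K1WitnessGaussPinHAtZB

end
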